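import Summits.AnomalousDissipation.AnomalousDissipation.Theorems.SawtoothPulseCascadeK1LocalisedCascadeOneFamily
import Summits.AnomalousDissipation.AnomalousDissipation.Theorems.SawtoothPulseCascadeK1LocalisedCascadeSlotMultiplierData
import Summits.AnomalousDissipation.AnomalousDissipation.Theorems.SawtoothPulseCascadeK1LocalisedCascadeMultiplierConstants

/-!
# K1loc, line `Spectral` / SeqCone — helper: THE DERIVATIVE-MULTIPLIER BUNDLE OF A FLAT-STRIP MULTIPLIER (S-B assembly, step 3)

Helper file of the prover lane on the crux `K1LocalisedCascade` (stmt-AnomalousDissipation-19491), route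
`SawtoothPulseCascade` (companion of `…K1LocalisedCascadeOneFamily`).  `…K1Ledger.fibre_estimate_one_family` asks, for the
un-gauging multiplier `Θ(x) = X(x_j)·twist P n (x_j)·e_b(x)` of one strip family, for its derivative multipliers `Θ_α`
(continuous, summable spectra, `𝓕Θ_α = (2πi q_j)^α 𝓕Θ`, `Θ_0 = Θ`) with sup bounds `‖Θ_α‖ ≤ B_α`.  When the un-gauging profile
`P` has CONSTANT slope `s` on an open set `U` off which the cut-off `X` vanishes locally (exact flats — the affine profile
`Ũ_j` of `…AffineProfileCascade`), the bricks `…SlotMultiplierData` (the circle functions `G_α` of `F^{(α)}`,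
`F(y) = X(y)e^{−2πinP(y)}e^{2πiby}`), `…SlotFlatLeibniz` (on the flats `F^{(α)} = p_α·phase` with the flat Leibniz sequence
`p_0 = X`, `p_{α+1} = p_α′ + c·p_α`, `c = 2πi(b − ns)`) and `…MultiplierConstants.norm_flatLeibniz_le`
(`‖p_α‖ ≤ Σ_{i≤α} C(α,i)‖c‖ⁱ D_{α−i}` from `|X^{(k)}| ≤ D_k`) assemble into exactly that bundle:
* `exists_multiplier_bundle` — `∃ Θ_•`, smooth, with the coefficient relation, `Θ_0 = Θ`, and
  `‖Θ_α(x)‖ ≤ Σ_{i≤α} C(α,i)(2π|b − ns|)ⁱ D_{α−i}`;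
* `fibre_estimate_one_family_of_flat` — `fibre_estimate_one_family` with the bundle supplied: the per-fibre one-family
  estimate from (X, P, U, s, D_•) plus the symbol data (compatibility, Taylor data, spectral moments).
* `exists_derivBound_extension` — finitely many derivative bounds (`k ≤ K`) extend to all orders (continuity +
  periodicity), so the explicit constants of `…MultiplierConstants` feed the bundle.
No definitions; no statement about the stub.
[cite: Grafakos2014, Prop. 3.1.2 (5) and Prop. 3.2.7 (3)] [problem: turb]
-/

-- `Summit.<Summit>.<Problem>`: single-conjunct summit, the duplicate namespace segment is deliberate.
set_option linter.dupNamespace false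

noncomputable section

namespace Summit.AnomalousDissipation.AnomalousDissipation.Theorems.SawtoothPulseCascade.K1Ledger

open MeasureTheory Set Filter Topology UnitAddTorus Complex
open scoped ComplexConjugate ContDiff
open Literature.Analysis Literature.Analysis.FunctionSpaces Literature.Analysis.FunctionSpaces.Torus
open Summit.AnomalousDissipation.AnomalousDissipation.Theorems.SawtoothPulseCascade.SpectralLeakage
open Summit.AnomalousDissipation.AnomalousDissipation.Theorems.SawtoothPulseCascade.K1Slot
open Summit.AnomalousDissipation.AnomalousDissipation.Theorems.SawtoothPulseCascade.K1Cutoff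

variable {d : Type*} [Fintype d] [DecidableEq d]

/-! ## §1 The bundle -/

/-- **The derivative-multiplier bundle of a flat-strip multiplier.**  Let `X, P` be profiles, `n, b ∈ ℤ`, `U ⊆ ℝ` a set on
which `P′ = s` and off which `y ↦ X(y)` vanishes locally (as a complex function), and `|X^{(k)}| ≤ D_k` for all `k`.  Then there
are functions `Θ_α : T^d → ℂ` (`α ∈ ℕ`), each smooth, with `𝓕Θ_α(q) = (2πi q_j)^α 𝓕Θ(q)`, `Θ_0 = Θ` where
`Θ(x) = X(x_j)·twist P n (x_j)·e_b(x)`, and `‖Θ_α(x)‖ ≤ Σ_{i≤α} C(α,i)·(2π|b − n s|)ⁱ·D_{α−i}` — namely the circle functions of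
the derivatives of `F(y) = X(y)e^{−2πinP(y)}e^{2πiby}` read off `x_j`. [cite: Grafakos2014, Prop. 3.1.2 (5)] -/
theorem exists_multiplier_bundle (X P : ShearProfile) (n b : ℤ) {U : Set ℝ} {s : ℝ} (hPU : ∀ y ∈ U, HasDerivAt P s y)
    (hXU : ∀ y, y ∉ U → (fun y : ℝ => (X y : ℂ)) =ᶠ[𝓝 y] 0) {D : ℕ → ℝ} (hD : ∀ k y, |iteratedDeriv k X y| ≤ D k)
    (j : d) :
    ∃ Θd : ℕ → UnitAddTorus d → ℂ, (∀ α, IsSmooth (Θd α)) ∧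
      (∀ α q, mFourierCoeff (Θd α) q = (2 * Real.pi * I * (q j : ℂ)) ^ α *
        mFourierCoeff (fun x : UnitAddTorus d => (X.onCircle (x j) : ℂ) * twist P n (x j) * mFourier (Pi.single j b) x) q) ∧
      (Θd 0 = fun x : UnitAddTorus d => (X.onCircle (x j) : ℂ) * twist P n (x j) * mFourier (Pi.single j b) x) ∧
      ∀ α x, ‖Θd α x‖ ≤ ∑ i ∈ Finset.range (α + 1), (α.choose i : ℝ) * (2 * Real.pi * |(b : ℝ) - n * s|) ^ i * D (α - i) := by
  classical
  -- the circle functions of `F^{(α)}`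
  set G : ℕ → UnitAddCircle → ℂ := fun α => (periodic_iteratedDeriv (periodic_multiplierFun X P n b) α).lift with hGdef
  have hG : ∀ α (y : ℝ), G α (y : UnitAddCircle) = iteratedDeriv α
      (fun y : ℝ => (X y : ℂ) * (cexp (-(2 * Real.pi * I * n * P y)) * cexp (2 * Real.pi * I * b * y))) y :=
    fun α y => by rw [hGdef]; exact Function.Periodic.lift_coe _ y
  -- the flat Leibniz sequence
  set c : ℂ := 2 * Real.pi * I * ((b : ℂ) - n * s) with hc
  set p : ℕ → ℝ → ℂ := fun α => Nat.rec (motive := fun _ => ℝ → ℂ) (fun y => (X y : ℂ))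
    (fun _ pα => fun y => deriv pα y + c * pα y) α with hp
  have hp0 : p 0 = fun y => (X y : ℂ) := rfl
  have hps : ∀ α, p (α + 1) = fun y => deriv (p α) y + c * p α y := fun α => rfl
  have hXc : ContDiff ℝ ∞ (fun y : ℝ => (X y : ℂ)) := ofRealCLM.contDiff.comp X.contDiff
  have hDc : ∀ k y, ‖iteratedDeriv k (fun y : ℝ => (X y : ℂ)) y‖ ≤ D k := fun k y => by
    rw [norm_iteratedDeriv_ofReal_comp X.contDiff]; exact hD k y
  have hB : ∀ α y, ‖p α y‖ ≤ ∑ i ∈ Finset.range (α + 1), (α.choose i : ℝ) * ‖c‖ ^ i * D (α - i) :=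
    fun α y => norm_flatLeibniz_le hXc hp0 hps hDc α y
  have hcn : ‖c‖ = 2 * Real.pi * |(b : ℝ) - n * s| := by
    rw [hc, show (2 * Real.pi * I * ((b : ℂ) - n * s) : ℂ) = (((2 * Real.pi * ((b : ℝ) - n * s) : ℝ) : ℂ)) * I by
      push_cast; ring, norm_mul, Complex.norm_I, mul_one, Complex.norm_real, Real.norm_eq_abs, abs_mul,
      abs_of_pos Real.two_pi_pos]
  refine ⟨fun α x => G α (x j), fun α => isSmooth_comp_eval_G X P n b hG j α,
    fun α q => mFourierCoeff_comp_eval_G X P n b hG j α q, ?_, fun α x => ?_⟩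
  · funext x; exact (multiplier_eq_G_zero X P n b hG j x).symm
  · have h := norm_comp_eval_G_le X P n b hG hPU hXU hp0 (by simpa [hc] using hps) hB j α x
    rwa [hcn] at h

/-! ## §2 The one-family estimate from flat-strip data -/

/-- **The per-fibre estimate for one strip family, multiplier bundle supplied.**  As `fibre_estimate_one_family`, with the
derivative multipliers and their sup bounds produced by `exists_multiplier_bundle` from: the exact slope `s` of the un-gauging
profile `P` on a set `U`, the local vanishing of the cut-off `X` off `U`, and derivative bounds `|X^{(k)}| ≤ D_k`
(`B_α = Σ_{i≤α} C(α,i)(2π|b − ns|)ⁱ D_{α−i}`).  The remaining data are the symbol data of the fibre: compatibility, Taylor data,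
spectral moments. [cite: Grafakos2014, Prop. 3.1.2 (5) and Prop. 3.2.7 (3)] -/
theorem fibre_estimate_one_family_of_flat {G : UnitAddTorus d → ℂ} {i j : d} (hG : IsSmooth G)
    (hij : i ≠ j) {n : ℤ} (hn : ∀ k, mFourierCoeff G k ≠ 0 → k i = n) (P X Z : ShearProfile)
    (hX1 : ∀ y, |X y| ≤ 1) (hZ : ∀ y, Z y = 0) (b : ℤ)
    {U : Set ℝ} {s : ℝ} (hPU : ∀ y ∈ U, HasDerivAt P s y) (hXU : ∀ y, y ∉ U → (fun y : ℝ => (X y : ℂ)) =ᶠ[𝓝 y] 0)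
    {D : ℕ → ℝ} (hD : ∀ k y, |iteratedDeriv k X y| ≤ D k)
    {r : ℕ} (hr : 0 < r)
    {m mn : (d → ℤ) → ℝ} (hmn : ∀ k, k i = n → mn k = m k) {M : ℝ} (hmnM : ∀ k, |mn k| ≤ M)
    {μ μn : (d → ℤ) → ℝ} (hμn : ∀ k, k i = n → μn k = μ k) {Mμ : ℝ} (hμnM : ∀ k, |μn k| ≤ Mμ)
    (hcomp : ∀ k : d → ℤ, k i = n → m (k - Pi.single j b) ^ 2 ≤ μ k ^ 2)
    {μd νd : ℕ → (d → ℤ) → ℂ} (hμd0 : ∀ k, μd 0 k = (μn k : ℂ)) {Mα : ℕ → ℝ}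
    (hMα : ∀ α ∈ Finset.range r, ∀ k, ‖μd α k‖ ≤ Mα α) {Md : ℝ} (hνd : ∀ α ∈ Finset.range r, ∀ k, ‖νd α k‖ ≤ Md)
    {ρ ρ₂ : (d → ℤ) → ℝ} {L L₂ : ℝ} (hρ0 : ∀ q, 0 ≤ ρ q) (hρ₂0 : ∀ q, 0 ≤ ρ₂ q) (hL : 0 ≤ L) (hL₂ : 0 ≤ L₂)
    (hT : ∀ k q, mFourierCoeff (fun x : UnitAddTorus d => (X.onCircle (x j) : ℂ) * twist P n (x j) *
        mFourier (Pi.single j b) x) q ≠ 0 →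
      ‖(μn k : ℂ) - ∑ α ∈ Finset.range r, (2 * Real.pi * I * (q j : ℂ)) ^ α * μd α (k - q)‖ ≤ L * ρ q)
    (hT₂ : ∀ k q, mFourierCoeff (fun x : UnitAddTorus d => (X.onCircle (x j) : ℂ) * twist P n (x j) *
        mFourier (Pi.single j b) x) q ≠ 0 →
      ‖((mn (k + Pi.single j (-b)) ^ 2 : ℝ) : ℂ) - ∑ α ∈ Finset.range r, (2 * Real.pi * I * (q j : ℂ)) ^ α * νd α (k - q)‖ ≤
        L₂ * ρ₂ q)
    (hρs : Summable fun q => ρ q * ‖mFourierCoeff (fun x : UnitAddTorus d => (X.onCircle (x j) : ℂ) * twist P n (x j) *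
        mFourier (Pi.single j b) x) q‖)
    (hρ₂s : Summable fun q => ρ₂ q * ‖mFourierCoeff (fun x : UnitAddTorus d => (X.onCircle (x j) : ℂ) * twist P n (x j) *
        mFourier (Pi.single j b) x) q‖) :
    ∑' k, m k ^ 2 * ‖mFourierCoeff (fun x => ((X.onCircle (x j) : ℂ) + Z.onCircle (x j)) * G (shearMap i j P x)) k‖ ^ 2 ≤
      (Real.sqrt (∑' k, μ k ^ 2 * ‖mFourierCoeff G k‖ ^ 2) +
          (∑ α ∈ Finset.Ico 1 r, (∑ i ∈ Finset.range (α + 1), (α.choose i : ℝ) * (2 * Real.pi * |(b : ℝ) - n * s|) ^ i *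
              D (α - i)) * Mα α + L * ∑' q, ρ q * ‖mFourierCoeff (fun x : UnitAddTorus d =>
              (X.onCircle (x j) : ℂ) * twist P n (x j) * mFourier (Pi.single j b) x) q‖) *
            Real.sqrt (∫ x, ‖G x‖ ^ 2)) ^ 2 +
        2 * (L₂ * ∑' q, ρ₂ q * ‖mFourierCoeff (fun x : UnitAddTorus d =>
            (X.onCircle (x j) : ℂ) * twist P n (x j) * mFourier (Pi.single j b) x) q‖) * ∫ x, ‖G x‖ ^ 2 := by
  obtain ⟨Θd, hsm, hcoef, h0, hBd⟩ := exists_multiplier_bundle X P n b hPU hXU hD j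
  exact fibre_estimate_one_family hG hij hn P X Z hX1 hZ b hr (fun α _ => (hsm α).continuous)
    (fun α _ => (hsm α).rapidDecay_mFourierCoeff.summable_norm) (fun α _ q => hcoef α q) h0 (fun α _ x => hBd α x)
    hmn hmnM hμn hμnM hcomp hμd0 hMα hνd hρ0 hρ₂0 hL hL₂ hT hT₂ hρs hρ₂s

/-! ## §3 Finitely many derivative bounds suffice -/

/-- **Extending finitely many derivative bounds.**  If `|X^{(k)}| ≤ D_k` for `k ≤ K`, there is a sequence `D'` agreeing
with `D` up to `K` and bounding ALL derivatives of the (smooth, periodic) profile `X` — each `X^{(k)}` is continuous and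
`1`-periodic, hence bounded.  So `exists_multiplier_bundle` / `…_of_flat` / `…_of_[fibre_]data` may be fed with the finitely
many explicit constants of `…MultiplierConstants` (`k ≤ 4`): the constants of order `> K` never enter their conclusions when
`K ≥ r + 2`. [folklore] -/
theorem exists_derivBound_extension (X : ShearProfile) {K : ℕ} {D : ℕ → ℝ}
    (hD : ∀ k ≤ K, ∀ y, |iteratedDeriv k X y| ≤ D k) :
    ∃ D' : ℕ → ℝ, (∀ k ≤ K, D' k = D k) ∧ ∀ k y, |iteratedDeriv k X y| ≤ D' k := by
  classical
  -- every derivative is bounded (continuous and periodic)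
  have hb : ∀ k, ∃ M : ℝ, ∀ y, |iteratedDeriv k X y| ≤ M := by
    intro k
    have hp : Function.Periodic (iteratedDeriv k X) 1 := by
      induction k with
      | zero => simpa [iteratedDeriv_zero] using X.periodic
      | succ k ih =>
          intro y
          have h : (fun y => iteratedDeriv k X (y + 1)) = iteratedDeriv k X := funext ih
          rw [iteratedDeriv_succ, ← deriv_comp_add_const, h]
    have hc : Continuous (iteratedDeriv k X) := X.contDiff.continuous_iteratedDeriv k (by exact_mod_cast le_top)
    obtain ⟨M, hM⟩ := isCompact_Icc.exists_bound_of_continuousOn (hc.continuousOn (s := Icc (0 : ℝ) 1))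
    refine ⟨M, fun y => ?_⟩
    obtain ⟨z, hz, hyz⟩ := hp.exists_mem_Ico₀ zero_lt_one y
    rw [hyz, ← Real.norm_eq_abs]
    exact hM z (Ico_subset_Icc_self hz)
  choose M hM using hb
  refine ⟨fun k => if k ≤ K then D k else M k, fun k hk => if_pos hk, fun k y => ?_⟩
  show |iteratedDeriv k X y| ≤ (if k ≤ K then D k else M k)
  by_cases hk : k ≤ K
  · rw [if_pos hk]; exact hD k hk y
  · rw [if_neg hk]; exact hM k y

end Summit.AnomalousDissipation.AnomalousDissipation.Theorems.SawtoothPulseCascade.K1Ledger
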